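import Literature.NumberTheory.Weil1964.RealWeilIndexEquivalence
import Mathlib.LinearAlgebra.QuadraticForm.Signature
import HarnessLib

/-!
# Weil's index of a real symmetric form and Sylvester's signature: `γ(f_S) = e^{iπ (σ⁺ - σ⁻)/4}`

Topic `NumberTheory/Weil1964`; namespace `Literature.NumberTheory.Weil1964`. KERNEL mathematics only
(theorems; no definition, no named fact, no `axiom`, no `sorry`). Sequel of `RealWeilIndexEquivalence.lean`.

[Weil1964, Chap. II n° 26 p. 173]: over `k = R` "toute forme quadratique non dégénérée est équivalente à une
forme `q_a(x) - q_b(y)` sur un espace `R^a × R^b`; `(a, b)` s'appelle le type d'inertie de la forme; la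
proposition 3 montre que, si `f` a le type d'inertie `(a, b)`, `γ(f) = γ(q₁)^{a-b}`", with `γ(q₁) = e^{πi/4}`.
Here the inertia `(a, b)` is Mathlib's CANONICAL signature of the quadratic form `Q_S(x) = xᵀ S x`
(`sigPos` / `sigNeg`: the maximal dimension of a positive / negative definite subspace — the uniqueness half
of Sylvester's law of inertia, `Mathlib.LinearAlgebra.QuadraticForm.Signature`), so that the index of
`RealWeilIndexEquivalence.lean` (`realWeilIndexSymm hS = ∏ γ(e^{2πi λᵢ x²})` over the eigenvalues) becomes a
function of the congruence class of `S`: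

* `equivalent_toQuadraticForm'_weightedSumSquares`: `Q_S` is equivalent to the weighted sum of squares
  `∑ λᵢ yᵢ²` (orthogonal eigenbasis, Mathlib's spectral theorem) — Weil's reduction to `q_a - q_b` up to
  positive scalars; hence `sigPos Q_S = #{λᵢ > 0}`, `sigNeg Q_S = #{λᵢ < 0}` (`sigPos_toQuadraticForm'`,
  `sigNeg_toQuadraticForm'`);
* **`realWeilIndexSymm_eq_cexp_sigPos_sub_sigNeg`**: `γ(f_S) = e^{iπ (sigPos Q_S - sigNeg Q_S)/4}` for EVERY
  real symmetric `S` (degenerate allowed — the radical does not contribute);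
* **`realWeilIndexSymm_congr_of_det_ne_zero`**: `γ(f_{PᵀSP}) = γ(f_S)` for every symmetric `S` and invertible
  `P` (no non-degeneracy hypothesis), by `QuadraticMap.Equivalent.sigPos_eq` — the algebraic counterpart of
  the analytic `realWeilIndexSymm_congr` of `RealWeilIndexCongruence.lean`.

## References

* [Weil1964] A. Weil, *Sur certains groupes d'opérateurs unitaires*, Acta Math. 111 (1964) 143–211, Chap. II
  n° 25–26 (pp. 173–174).
* Sylvester's law of inertia: Mathlib `QuadraticForm.sigPos_of_equiv_weightedSumSquares`; P. M. Cohn,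
  *Elements of Linear Algebra* (1994/2017), §8.5 Theorem 8.7 p. 135–136 ("the rank `r` and the signature
  `2s - r` are independent of the mode of reduction").
-/

set_option autoImplicit false

noncomputable section

open MeasureTheory Complex Filter Topology Set Finset QuadraticMap
open scoped Real BigOperators ComplexConjugate Matrix

namespace Literature.NumberTheory.Weil1964

variable {ι : Type*} [Fintype ι] [DecidableEq ι]

/-! ## §1 The quadratic form of a Gram matrix and its diagonalisation -/

/-- `Q_S(x) = xᵀ S x`. [cite: Weil1964, Chap. II n° 26, p. 173] -/
theorem toQuadraticForm'_apply_eq_dotProduct (S : Matrix ι ι ℝ) (x : ι → ℝ) :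
    S.toQuadraticForm' x = x ⬝ᵥ S *ᵥ x := by
  rw [Matrix.toQuadraticForm', LinearMap.BilinMap.toQuadraticMap_apply, Matrix.toLinearMap₂'_apply']

/-- the character of `S` is `e^{2πi Q_S}`. [cite: Weil1964, Chap. II n° 26, p. 173] -/
theorem symmChirp_eq_cexp_toQuadraticForm' (S : Matrix ι ι ℝ) (x : ι → ℝ) :
    symmChirp S x = cexp (2 * π * I * ((S.toQuadraticForm' x : ℝ) : ℂ)) := by
  rw [symmChirp_apply, toQuadraticForm'_apply_eq_dotProduct]

/-- congruent Gram matrices give composed forms: `Q_{PᵀSP} = Q_S ∘ P`. [cite: Weil1964, Chap. II n° 25, p. 173] -/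
theorem toQuadraticForm'_transpose_mul_mul (S P : Matrix ι ι ℝ) :
    (Pᵀ * S * P).toQuadraticForm' = S.toQuadraticForm'.comp (Matrix.toLin' P) := by
  ext x
  rw [QuadraticMap.comp_apply, toQuadraticForm'_apply_eq_dotProduct, toQuadraticForm'_apply_eq_dotProduct,
    Matrix.toLin'_apply, ← Matrix.mulVec_mulVec, ← Matrix.mulVec_mulVec, Matrix.dotProduct_mulVec,
    Matrix.vecMul_transpose]

/-- **diagonalisation** ("toute forme quadratique ... est équivalente à une forme `q_a(x) - q_b(y)`", up to
positive scalars): `Q_S` is equivalent to the weighted sum of squares `∑ λᵢ yᵢ²` over the eigenvalues of `S`,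
through the orthogonal eigenbasis `y = Uᵀ x`. [cite: Weil1964, Chap. II n° 26, p. 173] -/
theorem equivalent_toQuadraticForm'_weightedSumSquares {S : Matrix ι ι ℝ} (hS : S.IsHermitian) :
    S.toQuadraticForm'.Equivalent (QuadraticMap.weightedSumSquares ℝ hS.eigenvalues) := by
  set U : Matrix ι ι ℝ := (hS.eigenvectorUnitary : Matrix ι ι ℝ) with hU
  have hstar : star U = Uᵀ := by
    rw [Matrix.star_eq_conjTranspose, Matrix.conjTranspose_eq_transpose_of_trivial]
  have h1 : Uᵀ * U = 1 := by rw [← hstar]; exact Unitary.coe_star_mul_self hS.eigenvectorUnitary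
  have h2 : U * Uᵀ = 1 := by rw [← hstar]; exact Unitary.coe_mul_star_self hS.eigenvectorUnitary
  have hSd : S = (Uᵀ)ᵀ * Matrix.diagonal hS.eigenvalues * Uᵀ := by
    have h := hS.spectral_theorem
    have hre : (RCLike.ofReal ∘ hS.eigenvalues : ι → ℝ) = hS.eigenvalues := by
      funext i
      simp
    rw [Unitary.conjStarAlgAut_apply, ← hU, hstar, hre] at h
    rw [Matrix.transpose_transpose]
    exact h
  -- the form of the diagonal matrix is the weighted sum of squares
  have hdiag : (Matrix.diagonal hS.eigenvalues).toQuadraticForm' =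
      QuadraticMap.weightedSumSquares ℝ hS.eigenvalues := by
    ext y
    rw [toQuadraticForm'_apply_eq_dotProduct, QuadraticMap.weightedSumSquares_apply]
    simp only [dotProduct, Matrix.mulVec_diagonal, smul_eq_mul]
    exact Finset.sum_congr rfl fun i _ => by ring
  -- `Q_S = Q_{diag λ} ∘ Uᵀ` and `Uᵀ` is a linear automorphism
  set T : (ι → ℝ) ≃ₗ[ℝ] (ι → ℝ) := LinearEquiv.ofLinear (Matrix.toLin' Uᵀ) (Matrix.toLin' U)
    (by rw [← Matrix.toLin'_mul, h1, Matrix.toLin'_one]) (by rw [← Matrix.toLin'_mul, h2, Matrix.toLin'_one])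
    with hT
  have hcomp : S.toQuadraticForm' =
      (QuadraticMap.weightedSumSquares ℝ hS.eigenvalues).comp (T : (ι → ℝ) →ₗ[ℝ] (ι → ℝ)) := by
    rw [hT, LinearEquiv.ofLinear_toLinearMap, ← hdiag, ← toQuadraticForm'_transpose_mul_mul, ← hSd]
  rw [hcomp]
  exact ⟨(QuadraticMap.isometryEquivOfCompLinearEquiv _ T).symm⟩

/-- **the positive index of inertia of `Q_S` is the number of positive eigenvalues.**
[cite: Weil1964, Chap. II n° 26, p. 173] -/
theorem sigPos_toQuadraticForm' {S : Matrix ι ι ℝ} (hS : S.IsHermitian) :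
    sigPos S.toQuadraticForm' = (Finset.univ.filter fun i => 0 < hS.eigenvalues i).card := by
  rw [QuadraticForm.sigPos_of_equiv_weightedSumSquares (equivalent_toQuadraticForm'_weightedSumSquares hS),
    Set.ncard_eq_toFinset_card']
  congr 1
  ext i
  simp

/-- **the negative index of inertia of `Q_S` is the number of negative eigenvalues.**
[cite: Weil1964, Chap. II n° 26, p. 173] -/
theorem sigNeg_toQuadraticForm' {S : Matrix ι ι ℝ} (hS : S.IsHermitian) :
    sigNeg S.toQuadraticForm' = (Finset.univ.filter fun i => hS.eigenvalues i < 0).card := by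
  rw [QuadraticForm.sigNeg_of_equiv_weightedSumSquares (equivalent_toQuadraticForm'_weightedSumSquares hS),
    Set.ncard_eq_toFinset_card']
  congr 1
  ext i
  simp

/-! ## §2 `γ(f_S) = γ(q₁)^{a-b}` with Sylvester's canonical `(a, b)`, and congruence invariance -/

/-- the sum of the signs of the eigenvalues is `a - b`. [cite: Weil1964, Chap. II n° 26, p. 173] -/
theorem sum_sign_eigenvalues_eq {S : Matrix ι ι ℝ} (hS : S.IsHermitian) :
    ∑ i, (SignType.sign (hS.eigenvalues i) : ℝ) =
      ((sigPos S.toQuadraticForm' : ℝ)) - (sigNeg S.toQuadraticForm' : ℝ) := by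
  rw [sigPos_toQuadraticForm' hS, sigNeg_toQuadraticForm' hS]
  have hsplit : ∀ i, (SignType.sign (hS.eigenvalues i) : ℝ) =
      (if 0 < hS.eigenvalues i then (1 : ℝ) else 0) - (if hS.eigenvalues i < 0 then (1 : ℝ) else 0) := by
    intro i
    rcases lt_trichotomy (hS.eigenvalues i) 0 with h | h | h
    · rw [sign_neg h, if_neg (not_lt.2 h.le), if_pos h]; simp
    · rw [h, sign_zero]; simp
    · rw [sign_pos h, if_pos h, if_neg (not_lt.2 h.le)]; simp
  simp_rw [hsplit, Finset.sum_sub_distrib, Finset.sum_boole]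

/-- **`γ(f_S) = e^{iπ (a - b)/4}` with `(a, b) = (sigPos Q_S, sigNeg Q_S)` Sylvester's inertia of `xᵀ S x`**
— for every real symmetric `S` (the radical does not contribute). [cite: Weil1964, Chap. II n° 26, pp. 173–174] -/
theorem realWeilIndexSymm_eq_cexp_sigPos_sub_sigNeg {S : Matrix ι ι ℝ} (hS : S.IsHermitian) :
    realWeilIndexSymm hS =
      cexp (((π / 4 * ((sigPos S.toQuadraticForm' : ℝ) - (sigNeg S.toQuadraticForm' : ℝ)) : ℝ) : ℂ) * I) := by
  rw [realWeilIndexSymm_apply, realWeilIndexPi_eq_cexp, sum_sign_eigenvalues_eq hS]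

/-- equivalent forms: `Q_{PᵀSP}` and `Q_S` are equivalent for `P` invertible. [cite: Weil1964, Chap. II n° 25, p. 173] -/
theorem equivalent_toQuadraticForm'_congr (S : Matrix ι ι ℝ) {P : Matrix ι ι ℝ} (hP : P.det ≠ 0) :
    (Pᵀ * S * P).toQuadraticForm'.Equivalent S.toQuadraticForm' := by
  have hdetP : LinearMap.det (Matrix.toLin' P) ≠ 0 := by rwa [LinearMap.det_toLin']
  set A : (ι → ℝ) ≃ₗ[ℝ] (ι → ℝ) := LinearMap.equivOfDetNeZero (Matrix.toLin' P) hdetP with hA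
  have hcoe : (A : (ι → ℝ) →ₗ[ℝ] (ι → ℝ)) = Matrix.toLin' P := rfl
  rw [toQuadraticForm'_transpose_mul_mul, ← hcoe]
  exact ⟨(QuadraticMap.isometryEquivOfCompLinearEquiv _ A).symm⟩

/-- **congruent Gram matrices have the same Weil index** — for EVERY symmetric `S` (degenerate allowed) and every
invertible `P`: `γ(f_{PᵀSP}) = γ(f_S)` ("`γ` a même valeur pour deux formes équivalentes"), through
Sylvester's law (`QuadraticMap.Equivalent.sigPos_eq`). [cite: Weil1964, Chap. II n° 25, p. 173] -/
theorem realWeilIndexSymm_congr_of_det_ne_zero {S : Matrix ι ι ℝ} (hS : S.IsHermitian) {P : Matrix ι ι ℝ}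
    (hP : P.det ≠ 0) (hS' : (Pᵀ * S * P).IsHermitian) :
    realWeilIndexSymm hS' = realWeilIndexSymm hS := by
  rw [realWeilIndexSymm_eq_cexp_sigPos_sub_sigNeg hS', realWeilIndexSymm_eq_cexp_sigPos_sub_sigNeg hS,
    (equivalent_toQuadraticForm'_congr S hP).sigPos_eq, (equivalent_toQuadraticForm'_congr S hP).sigNeg_eq]

/-- the index only depends on the equivalence class of the quadratic form `Q_S`: if `Q_S` and `Q_{S'}` are
equivalent (isometric), the indices agree. [cite: Weil1964, Chap. II n° 25, p. 173] -/
theorem realWeilIndexSymm_eq_of_equivalent {S S' : Matrix ι ι ℝ} (hS : S.IsHermitian) (hS' : S'.IsHermitian)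
    (h : S.toQuadraticForm'.Equivalent S'.toQuadraticForm') :
    realWeilIndexSymm hS = realWeilIndexSymm hS' := by
  rw [realWeilIndexSymm_eq_cexp_sigPos_sub_sigNeg hS, realWeilIndexSymm_eq_cexp_sigPos_sub_sigNeg hS',
    h.sigPos_eq, h.sigNeg_eq]

end Literature.NumberTheory.Weil1964
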